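import Summits.QuantumFields.YangMills.Theorems.FradkinShenkerFlowSusceptibilityToPoincareStrongCoupling
import Summits.Ventures.YMGap.SlabAreaLawDimensions
import Summits.Ventures.YMGap.Thresholds.StarGeometry
import Literature.MathematicalPhysics.QuantumFieldTheory.Balaban1983to89.StrongCouplingTorusWindow
import Literature.MathematicalPhysics.QuantumLattice.TorusWilsonGibbs
import HarnessLib

/-!
# Robust ball (Y2) — THE HEAT-BATH POINCARÉ INEQUALITY (GLAUBER SPECTRAL GAP) OF STRONG-COUPLING `SU(N)` LATTICE YANG–MILLS,
# UNIFORMLY IN THE VOLUME, on the Kantorovich–Rubinstein window of the one-link modulus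

HONEST FRAMING: venture file of the cell `pub-ymgap` (QuantumFields programme), track ROBUST-BALL, seat rb-p2 (g12).  LATTICE statements at
STRONG COUPLING: a functional inequality for the torus Wilson measures `μ_{β,L}` of `SU(N)` on `(ℤ/L)⁴`, `L ≥ 2`, with a constant independent of `L`;
nothing about `β → ∞`, the continuum or Clay.  This is the DISCRETE-dynamics (single-link heat bath / Glauber) analogue of the functional
inequalities of Shen–Zhu–Zhu's dynamical approach (CMP 400 (2023), Langevin dynamics, Bakry–Émery window 't Hooft `|β| < 1/(16(d−1))`, i.e.
`β_W < 1/12` for `SU(2)`, `d = 4`); here the window is the Kantorovich–Rubinstein (Dobrushin) window of the cell's one-link modulus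
(`SU(2)`, `d = 4`: `β_W < 2/9`).

THE STATEMENT (`heatBathPoincare_of_oneLinkKRModulus`; the YangMills summit's `UP(r, β)` — conclusion of its crux `SusceptibilityToPoincare` — on tori
of side `≥ 2`): for `SU(N)`, `N ≥ 1`, tree coupling `β` with `(|β|/N)·6 ≤ R`, `OneLinkKRModulus N R K` and `c := 18 (|β|/N) K < 1`, every torus side `L ≥ 2`
and every bounded measurable `F`,
`Var_{μ_{β,L}}(F) ≤ (2(1 − c))⁻¹ ∑_ℓ ∫∫ (F(U) − F(U[ℓ ↦ g]))² dν_ℓ^U(g) dμ_{β,L}(U)`, `ν_ℓ^U = Haar.tilted(−β S_W(U[ℓ ↦ ·]))` the one-link heat bath: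
the heat-bath (random-scan Glauber) dynamics has a spectral gap `≥ 1 − c` uniformly in the volume.  ★★ `su2_heatBathPoincare`: `SU(2)`, `d = 4`,
HYPOTHESIS-FREE (quarter modulus): `0 ≤ β_W < 2/9` ⇒ constant `1/(2 − 9β_W)` on every torus of side `≥ 2` (tree coupling `β_W/2`).  For comparison the
YangMills summit's `heatBathPoincare_smallBeta` (same abstract engine, trivial one-link variance bound) has the window `β ≤ 1/(128(√N+1)(2√N+1)²)`
(`≈ 2·10⁻⁴` for `SU(2)`).
MECHANISM: the YangMills summit's abstract theorem `StrongPinningPoincare.HeatBath.variance_le_of_kr` (Wu 2006 / Ollivier 2009 in coupling-free form: a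
one-site Kantorovich–Rubinstein condition with COLUMN sums `≤ 1 − κ₀` gives the heat-bath Poincaré inequality with constant `(2κ₀)⁻¹`), fed with the
cell's one-link modulus through pub-balaban's torus dictionary (`StrongCouplingTorusWindow.siteLaw_torusWilson_thooft`: the one-link law of `μ_{β,L}` is
`ν_{B_ω}`, `B_ω = (β/N)·staple sum`; `frobNorm_tField_sub_le`; `matrixOpNorm_tField_le`) and the symmetric influence count `jointPlaq` (number of
plaquettes through two links, `tInfluence_le_jointPlaq`, column sums `≤ 18` by `sum_jointPlaq_le`).  0 sorry, 0 definitions.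
References: L. Wu, Ann. Probab. 34 (2006) 1960 (Dobrushin ⇒ Poincaré for Glauber dynamics); Y. Ollivier, J. Funct. Anal. 256 (2009) 810;
H. Shen, R. Zhu, X. Zhu, CMP 400 (2023) 805.  Everything here is proved. [folklore]
-/

noncomputable section

open MeasureTheory Function Real Filter Finset
open scoped ENNReal
open Literature.MathematicalPhysics.QuantumFieldTheory Literature.MathematicalPhysics.QuantumLattice
open Literature.MathematicalPhysics.QuantumFieldTheory.Balaban1983to89
open Literature.MathematicalPhysics.QuantumFieldTheory.Balaban1983to89.StrongCouplingTorusWindow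
open Literature.MathematicalPhysics.QuantumFieldTheory.Balaban1983to89.StrongCouplingDobrushinWindow (OneLinkKRModulus)
open Summit.QuantumFields.YangMills.Theorems.StrongPinningPoincare

namespace Summit.Ventures.YMGap.RobustBall.HeatBathPoincare

/-! ### Torus combinatorics: the staple influence count is dominated by the symmetric joint-plaquette count -/

section Combinatorics

variable {d L : ℕ} [NeZero L]

omit [NeZero L] in
/-- The three staple links of a plaquette through `e` lie on the plaquette. [folklore] -/
theorem tstapleLinks_mem_plaqEdgesT (q : Plaquette d L) (e : Edge d L) (k : Fin 3) :
    tstapleLinks q e k ∈ plaqEdgesT q := by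
  rw [plaqEdgesT_eq]
  unfold tstapleLinks
  split_ifs <;> fin_cases k <;> simp

/-- The three staple links of a plaquette through `e` are pairwise distinct (side `L ≥ 2`). [folklore] -/
theorem tstapleLinks_injective (hL : 1 < L) (q : Plaquette d L) (e : Edge d L) :
    Function.Injective (tstapleLinks q e) := by
  have h12 := tLink1_ne_tLink2 q
  have h13 := tLink1_ne_tLink3 hL q
  have h14 := tLink1_ne_tLink4 q
  have h23 := tLink2_ne_tLink3 q
  have h24 := tLink2_ne_tLink4 hL q
  have h34 := tLink3_ne_tLink4 q
  intro a b hab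
  unfold tstapleLinks at hab
  split_ifs at hab <;> fin_cases a <;> fin_cases b <;>
    simp_all [eq_comm]

/-- **The staple influence count is at most the joint-plaquette count**: `n(e, y) ≤ k(e, y)` on a torus of side `≥ 2`
(each plaquette through `e` contributes `y` at most once, and only if `y` lies on it). [folklore] -/
theorem tInfluence_le_jointPlaq (hL : 1 < L) (e y : Edge d L) : tInfluence e y ≤ jointPlaq e y := by
  classical
  unfold tInfluence jointPlaq
  rw [Finset.card_eq_sum_ones, Finset.sum_filter]
  refine Finset.sum_le_sum fun q _ => ?_
  by_cases hy : y ∈ plaqEdgesT q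
  · rw [if_pos hy]
    -- at most one of the three distinct staple links equals `y`
    have hinj := tstapleLinks_injective hL q e
    calc ∑ k : Fin 3, (if tstapleLinks q e k = y then 1 else 0)
        = ((Finset.univ : Finset (Fin 3)).filter fun k => tstapleLinks q e k = y).card := by
          rw [Finset.card_eq_sum_ones, Finset.sum_filter]
      _ ≤ 1 := Finset.card_le_one.2 fun a ha b hb => hinj ((Finset.mem_filter.1 ha).2.trans (Finset.mem_filter.1 hb).2.symm)
  · rw [if_neg hy]
    refine (Finset.sum_eq_zero fun k _ => ?_).le
    rw [if_neg]
    exact fun h => hy (h ▸ tstapleLinks_mem_plaqEdgesT q e k)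

/-- The joint-plaquette count vanishes off the plaquette neighbourhood. [folklore] -/
theorem jointPlaq_eq_zero_of_not_mem {x y : Edge d L} (hy : y ∉ linkNbrT x) (hyx : y ≠ x) : jointPlaq x y = 0 := by
  classical
  unfold jointPlaq
  rw [Finset.card_eq_zero, Finset.filter_eq_empty_iff]
  intro q hq hyq
  exact hy (mem_linkNbrT_iff.2 ⟨hyx, q, mem_plaqsThrough.1 hq, hyq⟩)

/-- **Column sums of the joint-plaquette count**: `∑_{i ≠ j} k(i, j) ≤ 6(d−1)` (symmetry and the row-sum bound `sum_jointPlaq_le`). [folklore] -/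
theorem sum_erase_jointPlaq_le (j : Edge d L) :
    ∑ i ∈ Finset.univ.erase j, (jointPlaq i j : ℝ) ≤ 6 * (d - 1 : ℕ) := by
  classical
  have hsplit : ∑ i ∈ Finset.univ.erase j, (jointPlaq i j : ℝ) = ∑ i ∈ linkNbrT j, (jointPlaq j i : ℝ) := by
    rw [← Finset.sum_subset (s₁ := linkNbrT j) (s₂ := Finset.univ.erase j)]
    · exact Finset.sum_congr rfl fun i _ => by rw [StarKernel.jointPlaq_comm]
    · intro i hi
      exact Finset.mem_erase.2 ⟨(mem_linkNbrT_iff.1 hi).1, Finset.mem_univ _⟩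
    · intro i hi hni
      rw [StarKernel.jointPlaq_comm, jointPlaq_eq_zero_of_not_mem hni (Finset.mem_erase.1 hi).1, Nat.cast_zero]
  rw [hsplit]
  exact sum_jointPlaq_le j

end Combinatorics

/-! ### The one-link heat bath of the torus Wilson measure in 't Hooft form -/

section HeatBath

variable {L N : ℕ} [NeZero L]

/-- `−β S_W = ∑_q log v_β(U_q)` for the fundamental representation of `SU(N)` (`v_β = exp(−β(N − Re tr))`). [folklore] -/
theorem neg_mul_wilsonAction_eq_torusLogWeight (β : ℝ) (U : GaugeConfig 4 L (Matrix.specialUnitaryGroup (Fin N) ℂ)) :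
    -β * wilsonAction (fundamentalRep (Fin N)) U = torusLogWeight (wilsonPlaqWeight N β) U := by
  unfold wilsonAction torusLogWeight
  rw [Finset.mul_sum]
  refine Finset.sum_congr rfl fun q _ => ?_
  rw [log_wilsonPlaqWeight, fundamentalRep_apply]
  ring

/-- **The one-link heat bath of `μ_{β,L}` is the tilted Haar law `ν_{B_U}`**, `B_U = (β/N)·(staple sum)` (side `L ≥ 2`):
`Haar.tilted(−β S_W(U[ℓ ↦ ·])) = Haar.tilted(N Re tr(· B_U))`. [folklore] -/
theorem heatBath_eq_tilted_tField (hL : 1 < L) (hN : 1 ≤ N) (β : ℝ) (ℓ : Edge 4 L)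
    (U : GaugeConfig 4 L (Matrix.specialUnitaryGroup (Fin N) ℂ)) :
    (haarProbability (Matrix.specialUnitaryGroup (Fin N) ℂ)).tilted
        (fun g => -β * wilsonAction (fundamentalRep (Fin N)) (update U ℓ g)) =
      (haarProbability (Matrix.specialUnitaryGroup (Fin N) ℂ)).tilted
        fun g => (N : ℝ) * ((g : Matrix (Fin N) (Fin N) ℂ) * tField β ℓ U).trace.re := by
  classical
  haveI : SecondCountableTopology (Matrix (Fin N) (Fin N) ℂ) :=
    inferInstanceAs (SecondCountableTopology (Fin N → Fin N → ℂ))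
  haveI : SecondCountableTopology (Matrix.specialUnitaryGroup (Fin N) ℂ) :=
    Topology.IsEmbedding.subtypeVal.secondCountableTopology
  have h1 : (fun g : Matrix.specialUnitaryGroup (Fin N) ℂ => -β * wilsonAction (fundamentalRep (Fin N)) (update U ℓ g)) =
      fun g => torusLogWeight (wilsonPlaqWeight N β) (update U ℓ g) :=
    funext fun g => neg_mul_wilsonAction_eq_torusLogWeight β _
  rw [h1, ← siteLaw_torusWeightSpec_eq_tilted_haar (continuous_wilsonPlaqWeight β) ℓ U, siteLaw_torusWilson_thooft hL hN β ℓ U]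

end HeatBath

/-! ### The heat-bath Poincaré inequality from the one-link modulus -/

section Main

variable {N : ℕ}

/-- ★★ **THE HEAT-BATH POINCARÉ INEQUALITY OF STRONG-COUPLING `SU(N)` LATTICE YANG–MILLS, UNIFORMLY IN THE VOLUME** (`d = 4`, tree coupling `β`,
every torus side `L ≥ 2`): if `(|β|/N)·6 ≤ R`, `OneLinkKRModulus N R K` and `18 (|β|/N) K ≤ c < 1`, then for every bounded measurable `F`,
`Var_{μ_{β,L}}(F) ≤ (2(1 − c))⁻¹ ∑_ℓ ∫∫ (F(U) − F(U[ℓ ↦ g]))² dν_ℓ^U(g) dμ_{β,L}(U)` with the one-link heat baths `ν_ℓ^U = Haar.tilted(−β S_W(U[ℓ ↦ ·]))` —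
the random-scan heat-bath dynamics has spectral gap `≥ 1 − c` on every torus (Wu 2006: Dobrushin's condition in Kantorovich form, column sums `≤ c`,
gives the Poincaré inequality; engine `StrongPinningPoincare.HeatBath.variance_le_of_kr`). [folklore] -/
theorem heatBathPoincare_of_oneLinkKRModulus (hN : 1 ≤ N) {β R K c : ℝ} (hK : 0 ≤ K) (hR : |β| / N * 6 ≤ R)
    (hmod : OneLinkKRModulus N R K) (hc : 18 * (|β| / N) * K ≤ c) (hc1 : c < 1) {L : ℕ} [NeZero L] (hL : 1 < L)
    (F : GaugeConfig 4 L (Matrix.specialUnitaryGroup (Fin N) ℂ) → ℝ) (hF : Measurable F) (hFb : ∃ M : ℝ, ∀ U, |F U| ≤ M) :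
    ProbabilityTheory.variance F (wilsonMeasure (d := 4) (L := L) (fundamentalRep (Fin N)) β) ≤
      (2 * (1 - c))⁻¹ * ∑ ℓ : Edge 4 L, ∫ U, ∫ g, (F U - F (update U ℓ g)) ^ 2
        ∂((haarProbability (Matrix.specialUnitaryGroup (Fin N) ℂ)).tilted
            (fun g' => -β * wilsonAction (fundamentalRep (Fin N)) (update U ℓ g')))
        ∂(wilsonMeasure (d := 4) (L := L) (fundamentalRep (Fin N)) β) := by
  classical
  haveI : SecondCountableTopology (Matrix (Fin N) (Fin N) ℂ) :=
    inferInstanceAs (SecondCountableTopology (Fin N → Fin N → ℂ))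
  haveI : SecondCountableTopology (Matrix.specialUnitaryGroup (Fin N) ℂ) :=
    Topology.IsEmbedding.subtypeVal.secondCountableTopology
  haveI : Nonempty (Fin N) := ⟨⟨0, hN⟩⟩
  obtain ⟨M, hM⟩ := hFb
  have hρc := continuous_fundamentalRep (Fin N)
  have hN0 : (0 : ℝ) < N := by exact_mod_cast (show 0 < N by omega)
  -- the log-density `V = -β S_W`
  set V : GaugeConfig 4 L (Matrix.specialUnitaryGroup (Fin N) ℂ) → ℝ := fun U => -β * wilsonAction (fundamentalRep (Fin N)) U with hV
  have hVm : Measurable V := (measurable_wilsonAction (fundamentalRep (Fin N)) hρc).const_mul _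
  obtain ⟨B₁, hB₁⟩ := exists_abs_wilsonAction_le (d := 4) (L := L) (G := Matrix.specialUnitaryGroup (Fin N) ℂ)
    (fundamentalRep (Fin N)) hρc
  have hVb : ∀ U, |V U| ≤ |β| * B₁ := fun U => by
    simp only [hV, abs_mul, abs_neg]
    exact mul_le_mul_of_nonneg_left (hB₁ U) (abs_nonneg _)
  -- the Frobenius distance on `SU(N)`
  have hdc : Continuous fun p : Matrix.specialUnitaryGroup (Fin N) ℂ × Matrix.specialUnitaryGroup (Fin N) ℂ => suFrobDist p.1 p.2 :=
    Lattice.continuous_frobNorm.comp ((continuous_subtype_val.comp continuous_fst).sub (continuous_subtype_val.comp continuous_snd))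
  have hd0 : ∀ e : Matrix.specialUnitaryGroup (Fin N) ℂ, suFrobDist e e = 0 := suFrobDist_self
  have hdsep : ∀ e e' : Matrix.specialUnitaryGroup (Fin N) ℂ, suFrobDist e e' = 0 → e = e' := fun e e' h =>
    Subtype.ext (sub_eq_zero.1 (Lattice.eq_zero_of_frobNorm_eq_zero h))
  have hdtri : ∀ a b c' : Matrix.specialUnitaryGroup (Fin N) ℂ, suFrobDist a c' ≤ suFrobDist a b + suFrobDist b c' :=
    fun a b c' => frobNorm_sub_le _ _ _
  -- the interaction matrix `c i j = K (|β|/N) k(i,j)` and its column sums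
  set cm : Edge 4 L → Edge 4 L → ℝ := fun i j => K * (|β| / N) * jointPlaq i j with hcm
  have hκ₀ : 0 < 1 - c := by linarith
  have hcnn : 0 ≤ c := le_trans (by positivity) hc
  have hcsum : ∀ j, ∑ i ∈ Finset.univ.erase j, cm i j ≤ 1 - (1 - c) := fun j => by
    simp only [hcm]
    rw [← Finset.mul_sum, sub_sub_cancel]
    calc K * (|β| / N) * ∑ i ∈ Finset.univ.erase j, (jointPlaq i j : ℝ) ≤ K * (|β| / N) * (6 * (4 - 1 : ℕ)) :=
          mul_le_mul_of_nonneg_left (sum_erase_jointPlaq_le j) (by positivity)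
      _ = 18 * (|β| / N) * K := by push_cast; ring
      _ ≤ c := hc
  -- the one-site Kantorovich–Rubinstein condition from the modulus
  have hKR : ∀ (i j : Edge 4 L), i ≠ j → ∀ (x : GaugeConfig 4 L (Matrix.specialUnitaryGroup (Fin N) ℂ))
      (a : Matrix.specialUnitaryGroup (Fin N) ℂ) (ψ : Matrix.specialUnitaryGroup (Fin N) ℂ → ℝ) (Lψ Mψ : ℝ), Measurable ψ →
      (∀ e, |ψ e| ≤ Mψ) → 0 ≤ Lψ → (∀ e e', |ψ e - ψ e'| ≤ Lψ * suFrobDist e e') →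
      |∫ e, ψ e ∂((haarProbability _).tilted fun e => V (update x i e)) -
        ∫ e, ψ e ∂((haarProbability _).tilted fun e => V (update (update x j a) i e))| ≤ Lψ * cm i j * suFrobDist (x j) a := by
    intro i j _ x a ψ Lψ Mψ hψm hψb hL0 hψL
    have e1 : (fun e => V (update x i e)) = fun g => -β * wilsonAction (fundamentalRep (Fin N)) (update x i g) := rfl
    have e2 : (fun e => V (update (update x j a) i e)) = fun g => -β * wilsonAction (fundamentalRep (Fin N)) (update (update x j a) i g) := rfl
    rw [e1, e2, heatBath_eq_tilted_tField hL hN β i x, heatBath_eq_tilted_tField hL hN β i (update x j a)]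
    have hB1 : matrixOpNorm (tField β i x) ≤ R :=
      (matrixOpNorm_tField_le (d := 4) (by norm_num) hN β i x).trans (by norm_num; linarith)
    have hB2 : matrixOpNorm (tField β i (update x j a)) ≤ R :=
      (matrixOpNorm_tField_le (d := 4) (by norm_num) hN β i _).trans (by norm_num; linarith)
    have key := hmod _ _ hB1 hB2 ψ Lψ hψm ⟨Mψ, hψb⟩ hL0 hψL
    have hdiff : frobNorm (tField β i x - tField β i (update x j a)) ≤ |β| / N * tInfluence i j * suFrobDist (x j) a := by
      have h := frobNorm_tField_sub_le (N := N) hL β i j (ω := x) (η := update x j a) (fun z hz => by rw [update_of_ne hz])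
      simpa only [update_self] using h
    have hinf : (tInfluence i j : ℝ) ≤ jointPlaq i j := by exact_mod_cast tInfluence_le_jointPlaq hL i j
    have hd0' : 0 ≤ suFrobDist (x j) a := suFrobDist_nonneg _ _
    calc _ ≤ K * Lψ * frobNorm (tField β i x - tField β i (update x j a)) := key
      _ ≤ K * Lψ * (|β| / N * jointPlaq i j * suFrobDist (x j) a) := by
          refine mul_le_mul_of_nonneg_left (hdiff.trans ?_) (mul_nonneg hK hL0)
          exact mul_le_mul_of_nonneg_right (mul_le_mul_of_nonneg_left hinf (by positivity)) hd0'
      _ = Lψ * cm i j * suFrobDist (x j) a := by simp only [hcm]; ring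
  -- the abstract theorem
  have key := HeatBath.variance_le_of_kr (ι := Edge 4 L) (haarProbability (Matrix.specialUnitaryGroup (Fin N) ℂ)) hVm hVb
    suFrobDist hdc hd0 suFrobDist_nonneg suFrobDist_comm hdtri hdsep suFrobDist_le cm hκ₀ (by linarith) hcsum hKR hF hM
  have hμ : wilsonMeasure (d := 4) (L := L) (fundamentalRep (Fin N)) β =
      (Measure.pi fun _ : Edge 4 L => haarProbability (Matrix.specialUnitaryGroup (Fin N) ℂ)).tilted V :=
    wilsonMeasure_eq_tilted_pi (fundamentalRep (Fin N)) hρc β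
  rw [hμ]
  simpa only [hV] using key

/-- ★★ **`SU(2)`, `d = 4`, HYPOTHESIS-FREE: THE HEAT-BATH POINCARÉ INEQUALITY UNIFORMLY IN THE VOLUME on `0 ≤ β_W < 2/9`** (tree coupling `β_W/2`,
quarter modulus `OneLinkKRModulus 2 R 1`): on every torus `(ℤ/L)⁴`, `L ≥ 2`, for every bounded measurable `F`,
`Var_{μ}(F) ≤ (2 − 9β_W)⁻¹ ∑_ℓ ∫∫ (F(U) − F(U[ℓ ↦ g]))² dν_ℓ^U dμ` — the single-link heat-bath dynamics of strong-coupling 4D `SU(2)` lattice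
Yang–Mills has a spectral gap `≥ 1 − 9β_W/2` uniformly in the volume (Shen–Zhu–Zhu's printed Bakry–Émery window is `β_W < 1/12`, for the Langevin
dynamics). [folklore] -/
theorem su2_heatBathPoincare {βW : ℝ} (h0 : 0 ≤ βW) (h : βW < 2 / 9) {L : ℕ} [NeZero L] (hL : 1 < L)
    (F : GaugeConfig 4 L (Matrix.specialUnitaryGroup (Fin 2) ℂ) → ℝ) (hF : Measurable F) (hFb : ∃ M : ℝ, ∀ U, |F U| ≤ M) :
    ProbabilityTheory.variance F (wilsonMeasure (d := 4) (L := L) (fundamentalRep (Fin 2)) (βW / 2)) ≤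
      (2 - 9 * βW)⁻¹ * ∑ ℓ : Edge 4 L, ∫ U, ∫ g, (F U - F (update U ℓ g)) ^ 2
        ∂((haarProbability (Matrix.specialUnitaryGroup (Fin 2) ℂ)).tilted
            (fun g' => -(βW / 2) * wilsonAction (fundamentalRep (Fin 2)) (update U ℓ g')))
        ∂(wilsonMeasure (d := 4) (L := L) (fundamentalRep (Fin 2)) (βW / 2)) := by
  have habs : |βW / 2| = βW / 2 := abs_of_nonneg (by positivity)
  have key := heatBathPoincare_of_oneLinkKRModulus (N := 2) (by norm_num) (β := βW / 2) zero_le_one (R := 3 * βW / 2)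
    (by rw [habs]; push_cast; linarith) (SlabAreaLawDimensions.su2_oneLinkKRModulus_of_le_one (by linarith)) (c := 9 * βW / 2)
    (by rw [habs]; push_cast; linarith) (by linarith) hL F hF hFb
  have e : (2 * (1 - 9 * βW / 2))⁻¹ = (2 - 9 * βW)⁻¹ := by congr 1; ring
  rw [e] at key
  exact key

/-- **The YangMills summit's `UP(r, β)` shape on the odd tori of side `≥ 3`** (`SU(2)`, `0 ≤ β_W < 2/9`): for every `S ≥ 1` and every bounded
measurable `F` on `((ℤ/(2S+1))⁴`-links, the heat-bath Poincaré inequality with constant `(2 − 9β_W)⁻¹`. [folklore] -/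
theorem su2_heatBathPoincare_oddTorus {βW : ℝ} (h0 : 0 ≤ βW) (h : βW < 2 / 9) (S : ℕ) (hS : 1 ≤ S)
    (F : GaugeConfig 4 (2 * S + 1) (Matrix.specialUnitaryGroup (Fin 2) ℂ) → ℝ) (hF : Measurable F)
    (hFb : ∃ M : ℝ, ∀ U, |F U| ≤ M) :
    ProbabilityTheory.variance F (wilsonMeasure (d := 4) (L := 2 * S + 1) (fundamentalRep (Fin 2)) (βW / 2)) ≤
      (2 - 9 * βW)⁻¹ * ∑ ℓ : Edge 4 (2 * S + 1), ∫ U, ∫ g, (F U - F (update U ℓ g)) ^ 2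
        ∂((haarProbability (Matrix.specialUnitaryGroup (Fin 2) ℂ)).tilted
            (fun g' => -(βW / 2) * wilsonAction (fundamentalRep (Fin 2)) (update U ℓ g')))
        ∂(wilsonMeasure (d := 4) (L := 2 * S + 1) (fundamentalRep (Fin 2)) (βW / 2)) :=
  su2_heatBathPoincare h0 h (by omega) F hF hFb

end Main

end Summit.Ventures.YMGap.RobustBall.HeatBathPoincare

end
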